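import Summits.CriticalPhenomena.SAWScalingLimit.Theorems.SAWDevelopingMapNoFoldBoundDepthTwoClasses
import Summits.CriticalPhenomena.SAWScalingLimit.Theorems.SAWDevelopingMapNoFoldBoundSealedPort
import Summits.CriticalPhenomena.SAWScalingLimit.Theorems.SAWDevelopingMapNoFoldBoundThreeClassMin
import Summits.CriticalPhenomena.SAWScalingLimit.Theorems.SAWDevelopingMapNoFoldBoundInteriorSlit

/-!
# `NoFoldBound`, line Ideator3Sketch — depth-2 stratum, part I: numerics and phase bookkeeping

Crux `NoFoldBound` (stmt-CriticalPhenomena-8296), route `SAWDevelopingMap`, lead seat c3. Support for the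
depth-2 theorem `depthTwo_core` (part II, file `…NoFoldBoundDepthTwoPort`):

* one-step windings written through centres (`winding_center_center_mid`, `…'`), to read the class of the
  touching port off `depthTwo_portClass` with `stub_localTurns`;
* numerics: `cos(5π/12) = √2(√3 − 1)/4`, `cos²(5π/24) = 1/2 + √2(√3 − 1)/8`, enclosures of `cos(5π/24)`,
  `cos(11π/24) = sin(π/24)`, `x_c`, and the DRESSING BOX `dressed_box`: for a slit-loop sum `0 ≤ Z ≤ 1/5`,
  `(3/5)(α_T − √3x_cZ) ≤ β_T + √3x_cZ ≤ (4/5)(α_T − √3x_cZ)` (`β_T/α_T = 0.614`, `r(1/5) = 0.795`);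
* phase bookkeeping at `σ = 5/8`: `e^{-iσ(W+t)} = e^{-iσW}e^{-iσt}`, `e^{-iσ·2π/3} = e^{-5πi/12}`,
  `e^{-iσ(-4π/3)} = (e^{5πi/12})²`, `ω² e^{-5πi/12} = e^{-13πi/12}`, `ω e^{5πi/12} = e^{13πi/12}`;
* `sum_ite_pow_mul_ge` (termwise lower comparison of dressed restricted sums).

Pure trigonometry / bookkeeping; nothing about the crux is asserted. [folklore]
-/

noncomputable section

open scoped BigOperators
open Literature.Probability.LatticeModels Literature.Probability.RandomPlanarGeometry.SAW

namespace Summit.CriticalPhenomena.SAWScalingLimit.Theorems.SAWDevelopingMapNoFoldBound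


/-! ## One-step windings written through centres -/

/-- `winding [c y, c w, mid{v,w}] = winding [mid{y,w}, c w, mid{w,v}]` (both are the turning of
`c y → c w → c v`). [folklore] -/
theorem winding_center_center_mid (y w v : HexVertex) :
    winding [hexCenter y, hexCenter w, hexMidpoint s(v, w)] =
      winding [hexMidpoint s(y, w), hexCenter w, hexMidpoint s(w, v)] := by
  rw [winding_step_eq_turning, winding_cons_cons_cons, winding_pair, add_zero, hexMidpoint_mk,
    show (hexCenter v + hexCenter w) / 2 =
        hexCenter w + ((1 / 2 : ℝ) : ℂ) * (hexCenter v - hexCenter w) by push_cast; ring,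
    HV.turning_right_ray (by norm_num : (0 : ℝ) < 1 / 2)]

/-- `winding [c y, c w, mid{w,x}] = winding [mid{y,w}, c w, mid{w,x}]`. [folklore] -/
theorem winding_center_center_mid' (y w x : HexVertex) :
    winding [hexCenter y, hexCenter w, hexMidpoint s(w, x)] =
      winding [hexMidpoint s(y, w), hexCenter w, hexMidpoint s(w, x)] := by
  rw [winding_step_eq_turning, winding_cons_cons_cons, winding_pair, add_zero, hexMidpoint_mk,
    show (hexCenter w + hexCenter x) / 2 =
        hexCenter w + ((1 / 2 : ℝ) : ℂ) * (hexCenter x - hexCenter w) by push_cast; ring,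
    HV.turning_right_ray (by norm_num : (0 : ℝ) < 1 / 2)]

/-! ## Numerics: the dressing box for loop sums `≤ 1/5` -/

/-- `cos(5π/12) = √2 (√3 − 1)/4`. -/
theorem cos_five_pi_div_twelve_eq : Real.cos (5 * Real.pi / 12) = Real.sqrt 2 * (Real.sqrt 3 - 1) / 4 := by
  rw [show 5 * Real.pi / 12 = Real.pi / 4 + Real.pi / 6 by ring, Real.cos_add, Real.cos_pi_div_four,
    Real.sin_pi_div_four, Real.cos_pi_div_six, Real.sin_pi_div_six]
  ring

/-- `cos²(5π/24) = 1/2 + √2 (√3 − 1)/8`. -/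
theorem cos_sq_five_pi_div_24 : Real.cos (5 * Real.pi / 24) ^ 2 = 1 / 2 + Real.sqrt 2 * (Real.sqrt 3 - 1) / 8 := by
  rw [Real.cos_sq, show 2 * (5 * Real.pi / 24) = 5 * Real.pi / 12 by ring, cos_five_pi_div_twelve_eq]
  ring

/-- `0.7933 ≤ cos(5π/24) ≤ 0.7934`. -/
theorem cos_five_pi_div_24_bounds :
    (0.7933 : ℝ) ≤ Real.cos (5 * Real.pi / 24) ∧ Real.cos (5 * Real.pi / 24) ≤ 0.7934 := by
  have h2l : (1.4142 : ℝ) ≤ Real.sqrt 2 := Real.le_sqrt_of_sq_le (by norm_num)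
  have h2u : Real.sqrt 2 ≤ 1.41422 := le_of_lt ((Real.sqrt_lt' (by norm_num)).2 (by norm_num))
  obtain ⟨h3l, h3u⟩ := sqrt_three_bounds
  have hsq := cos_sq_five_pi_div_24
  have hc0 : 0 ≤ Real.cos (5 * Real.pi / 24) :=
    Real.cos_nonneg_of_mem_Icc ⟨by linarith [Real.pi_pos], by linarith [Real.pi_pos]⟩
  have hprod_l : (1.4142 : ℝ) * (1.732 - 1) ≤ Real.sqrt 2 * (Real.sqrt 3 - 1) :=
    mul_le_mul h2l (by linarith) (by norm_num) (by linarith)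
  have hprod_u : Real.sqrt 2 * (Real.sqrt 3 - 1) ≤ 1.41422 * (1.73206 - 1) :=
    mul_le_mul h2u (by linarith) (by linarith) (by norm_num)
  constructor <;> nlinarith

/-- `0.1303 ≤ cos(11π/24) ≤ 0.1309` (`cos(11π/24) = sin(π/24)`). -/
theorem cos_eleven_pi_div_24_bounds :
    (0.1303 : ℝ) ≤ Real.cos (11 * Real.pi / 24) ∧ Real.cos (11 * Real.pi / 24) ≤ 0.1309 := by
  rw [show 11 * Real.pi / 24 = Real.pi / 2 - Real.pi / 24 by ring, Real.cos_pi_div_two_sub]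
  have hpl := Real.pi_gt_d4
  have hpu := Real.pi_lt_d4
  constructor
  · have h := Real.sin_gt_sub_cube (x := Real.pi / 24) (by positivity)
    have hc : (Real.pi / 24) ^ 3 ≤ (0.1309 : ℝ) ^ 3 := pow_le_pow_left₀ (by positivity) (by linarith) 3
    have hc' : ((0.1309 : ℝ)) ^ 3 ≤ 0.002243 := by norm_num
    linarith
  · have h := Real.sin_lt (x := Real.pi / 24) (by positivity)
    linarith

/-- `0.5411 ≤ x_c ≤ 0.5413` (`x_c² (2 + √2) = 1`). -/
theorem xc_bounds : (0.5411 : ℝ) ≤ hexCriticalFugacity ∧ hexCriticalFugacity ≤ 0.5413 := by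
  have h := hexCriticalFugacity_sq
  have h0 := nfb_xc_pos
  have h2l : (1.4142 : ℝ) ≤ Real.sqrt 2 := Real.le_sqrt_of_sq_le (by norm_num)
  have h2u : Real.sqrt 2 ≤ 1.41422 := le_of_lt ((Real.sqrt_lt' (by norm_num)).2 (by norm_num))
  constructor
  · by_contra hlt
    push Not at hlt
    have : hexCriticalFugacity ^ 2 * (2 + Real.sqrt 2) < 0.5411 ^ 2 * (2 + 1.41422) := by
      have hsq : hexCriticalFugacity ^ 2 < 0.5411 ^ 2 := by nlinarith
      calc hexCriticalFugacity ^ 2 * (2 + Real.sqrt 2) ≤ hexCriticalFugacity ^ 2 * (2 + 1.41422) :=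
            mul_le_mul_of_nonneg_left (by linarith) (sq_nonneg _)
        _ < 0.5411 ^ 2 * (2 + 1.41422) := mul_lt_mul_of_pos_right hsq (by norm_num)
    nlinarith
  · by_contra hlt
    push Not at hlt
    have : 0.5413 ^ 2 * (2 + 1.4142) < hexCriticalFugacity ^ 2 * (2 + Real.sqrt 2) := by
      have hsq : (0.5413 : ℝ) ^ 2 < hexCriticalFugacity ^ 2 := by nlinarith
      calc (0.5413 : ℝ) ^ 2 * (2 + 1.4142) ≤ 0.5413 ^ 2 * (2 + Real.sqrt 2) :=
            mul_le_mul_of_nonneg_left (by linarith) (sq_nonneg _)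
        _ < hexCriticalFugacity ^ 2 * (2 + Real.sqrt 2) := mul_lt_mul_of_pos_right hsq (by positivity)
    nlinarith

/-- **Dressing box.** For a loop sum `0 ≤ Z ≤ 1/5`:
`(3/5)(α_T − √3 x_c Z) ≤ β_T + √3 x_c Z ≤ (4/5)(α_T − √3 x_c Z)` and `0 ≤ α_T − √3 x_c Z`
(`β_T/α_T = 0.614 ≥ 3/5`, `(β_T + √3x_c/5)/(α_T − √3x_c/5) = 0.795 ≤ 4/5`). [folklore] -/
theorem dressed_box {Z : ℝ} (hZ0 : 0 ≤ Z) (hZ : Z ≤ 1 / 5) :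
    3 / 5 * ((1 + 2 * hexCriticalFugacity * Real.cos (5 * Real.pi / 24)) - Real.sqrt 3 * hexCriticalFugacity * Z) ≤
      (1 + 2 * hexCriticalFugacity * Real.cos (11 * Real.pi / 24)) + Real.sqrt 3 * hexCriticalFugacity * Z ∧
    (1 + 2 * hexCriticalFugacity * Real.cos (11 * Real.pi / 24)) + Real.sqrt 3 * hexCriticalFugacity * Z ≤
      4 / 5 * ((1 + 2 * hexCriticalFugacity * Real.cos (5 * Real.pi / 24)) - Real.sqrt 3 * hexCriticalFugacity * Z) ∧
    0 ≤ (1 + 2 * hexCriticalFugacity * Real.cos (5 * Real.pi / 24)) - Real.sqrt 3 * hexCriticalFugacity * Z := by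
  obtain ⟨hxl, hxu⟩ := xc_bounds
  obtain ⟨h5l, h5u⟩ := cos_five_pi_div_24_bounds
  obtain ⟨h11l, h11u⟩ := cos_eleven_pi_div_24_bounds
  obtain ⟨h3l, h3u⟩ := sqrt_three_bounds
  set x := hexCriticalFugacity with hx
  have x0 : 0 ≤ x := by linarith
  have hr3x : Real.sqrt 3 * x ≤ 1.73206 * 0.5413 := mul_le_mul h3u hxu x0 (by norm_num)
  have hr3x0 : 0 ≤ Real.sqrt 3 * x := by positivity
  have hZx : Real.sqrt 3 * x * Z ≤ 1.73206 * 0.5413 * (1 / 5) := mul_le_mul hr3x hZ hZ0 (by norm_num)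
  have hZx0 : 0 ≤ Real.sqrt 3 * x * Z := by positivity
  have hα_u : 2 * x * Real.cos (5 * Real.pi / 24) ≤ 2 * 0.5413 * 0.7934 := by
    have := mul_le_mul hxu h5u (by linarith) (by norm_num : (0 : ℝ) ≤ 0.5413); nlinarith
  have hα_l : 2 * 0.5411 * 0.7933 ≤ 2 * x * Real.cos (5 * Real.pi / 24) := by
    have := mul_le_mul hxl h5l (by norm_num) x0; nlinarith
  have hβ_l : 2 * 0.5411 * 0.1303 ≤ 2 * x * Real.cos (11 * Real.pi / 24) := by
    have := mul_le_mul hxl h11l (by norm_num) x0; nlinarith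
  have hβ_u : 2 * x * Real.cos (11 * Real.pi / 24) ≤ 2 * 0.5413 * 0.1309 := by
    have := mul_le_mul hxu h11u (by linarith) (by norm_num : (0 : ℝ) ≤ 0.5413); nlinarith
  refine ⟨by nlinarith, by nlinarith, by nlinarith⟩

/-! ## Phase bookkeeping -/

/-- Splitting a phase factor: `e^{-iσ(W + t)} = e^{-iσW} e^{-iσt}`. [folklore] -/
theorem exp_add_phase (σ W t : ℝ) :
    Complex.exp (-Complex.I * σ * ((W + t : ℝ) : ℂ)) =
      Complex.exp (-Complex.I * σ * (W : ℂ)) * Complex.exp (-Complex.I * σ * (t : ℂ)) := by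
  rw [← Complex.exp_add]
  congr 1
  push_cast
  ring

/-- `e^{-iσ·2π/3} = e^{-5πi/12}` (`σ = 5/8`). [folklore] -/
theorem exp_neg_sigma_eq :
    Complex.exp (-Complex.I * (5 / 8 : ℝ) * ((2 * Real.pi / 3 : ℝ) : ℂ)) =
      Complex.exp (-((5 * Real.pi / 12 : ℝ) * Complex.I)) := by
  congr 1
  push_cast
  ring

/-- `e^{-iσ·(-4π/3)} = (e^{5πi/12})²` (`σ = 5/8`). [folklore] -/
theorem exp_neg_sigma_neg_four_pi_div_three :
    Complex.exp (-Complex.I * (5 / 8 : ℝ) * ((-(4 * Real.pi / 3) : ℝ) : ℂ)) =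
      Complex.exp ((5 * Real.pi / 12 : ℝ) * Complex.I) ^ 2 := by
  rw [sq, ← Complex.exp_add]
  congr 1
  push_cast
  ring

/-- `ω² · e^{-5πi/12} = e^{-13πi/12}` (`ω = e^{2πi/3}`; both sides equal `e^{11πi/12}`). [folklore] -/
theorem omega_sq_mul_exp_neg :
    Complex.exp (2 * Real.pi * Complex.I / 3) ^ 2 * Complex.exp (-((5 * Real.pi / 12 : ℝ) * Complex.I)) =
      Complex.exp (-((13 * Real.pi / 12 : ℝ) * Complex.I)) := by
  rw [sq, ← Complex.exp_add, ← Complex.exp_add]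
  have h : Complex.exp (-((13 * Real.pi / 12 : ℝ) * Complex.I)) =
      Complex.exp (-((13 * Real.pi / 12 : ℝ) * Complex.I) + 2 * Real.pi * Complex.I) := by
    rw [Complex.exp_add, Complex.exp_two_pi_mul_I, mul_one]
  rw [h]
  congr 1
  push_cast
  ring

/-- `ω · e^{5πi/12} = e^{13πi/12}`. [folklore] -/
theorem omega_mul_expQ :
    Complex.exp (2 * Real.pi * Complex.I / 3) * Complex.exp ((5 * Real.pi / 12 : ℝ) * Complex.I) =
      Complex.exp ((13 * Real.pi / 12 : ℝ) * Complex.I) := by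
  rw [← Complex.exp_add]
  congr 1
  push_cast
  ring

/-- Comparison of two real dressed restricted sums, lower version (`k r' ≤ r` termwise). [folklore] -/
theorem sum_ite_pow_mul_ge {Λ : Finset HexVertex} {a z : Sym2 HexVertex}
    (P : HexMidEdgeSAW Λ a z → Prop) [DecidablePred P] {x k : ℝ}
    (hx : 0 ≤ x) (r r' : HexMidEdgeSAW Λ a z → ℝ)
    (h : ∀ γ : HexMidEdgeSAW Λ a z, P γ → k * r' γ ≤ r γ) :
    k * (∑ γ : HexMidEdgeSAW Λ a z, if P γ then x ^ γ.length * r' γ else 0) ≤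
      ∑ γ : HexMidEdgeSAW Λ a z, if P γ then x ^ γ.length * r γ else 0 := by
  rw [Finset.mul_sum]
  refine Finset.sum_le_sum fun γ _ => ?_
  by_cases hγ : P γ
  · rw [if_pos hγ, if_pos hγ]
    have := mul_le_mul_of_nonneg_left (h γ hγ) (pow_nonneg hx γ.length)
    linarith
  · rw [if_neg hγ, if_neg hγ, mul_zero]

end Summit.CriticalPhenomena.SAWScalingLimit.Theorems.SAWDevelopingMapNoFoldBound
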